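import Summits.AtomisticToContinuum.Crystallization.Theorems.FrustratedLawDichotomyStrainedPatchGradedDescent

/-!
# GradedStage — the LP stage tables of GradStep ON THE GRADED TUBE and the T-leaf record in graded table currency (lens-5 g78; part 2 of 2)

Part 1 (`…GradedDescent`) threads the per-host-site tolerance table `T` of `…GradedTube` (g77) through the row-priced descent: graded cluster
formats, graded host reading `HostReadingG τ T` (`‖D h‖ ≤ T h` on the occupancy), graded host tables, ★★★ `tubeFloorG_of_hostTabsG`.  This part
grades the LP stage format of `…GradStep` (g76) — every instrument a LINEAR-objective sup over the GLOBAL GRADED row polytope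
{`D` : `‖D h‖ ≤ T(h)` on `O`, `D c₀ = 0`, `‖hostLin(h′)‖ ≤ σ + Y(h′)` at the sure-reach rows} or closed-form table arithmetic:

* §3 `HostDiffTabG`, `HostPairTabG`, `DiffEvalTabG`, `PairEvalTabG`; the bridges ★★ `hostStepTabG_of_diffTabG`, ★★★ `hostStepTabG_of_pairTabG`
  [PROVED over GradStep's `hostQuad_le_diffEval` / `hostQuad_le_pairEval`]; the GRADED BOX TABLE `boxTabG T (h, h′) = T h + T h′`, valid on every
  graded reading [PROVED, `hostDiffTabG_box`; `= boxTab τ` at the constant table], hence ★★ THE GRADED START `hostTopTabG_of_diffEvalTabG_box`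
  (interior rows pay `2τ_in`, mixed rows `τ_in + τ_out`, rim rows `2τ_out` at the two-level profile `gradeTol R_g τ_in τ_out`); the graded PAIR BOXES
  `pairBoxG₁ T Tn = T h′ + Tn h`, `pairBoxG₂ T Tn = T h′ + Tn h + 2·T h` under NEAR DOMINATION `NearDom r T Tn` [PROVED, `hostPairTabG_box`];
  every record table / evaluation is a graded one at every `T`, graded ones ANTITONE in `T` [PROVED].
* §4 `StageCertG` (graded difference tables ∧ graded pair tables ∧ graded paired evaluation), ★★★ `tubeFloorG_of_envelope_tailCert_pairTabsG`
  ((TF-G) from `2τ < s₀`, host separation, `r + 2τ ≤ 7`, (HFAR), (TAILCERT), `X ≥ Xh + Xe`, `PairAdm`, START by graded box evaluation, `n` graded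
  LP stages on `addCol X (P i)`, graded terminal on `addCol X (P n)`), ★★★ `coreOff_of_envelope_tailCert_pairTabsG` ([CORE-FAR] with the GRADED
  cover, g77's junction), ★★ the two-level instance at the scalar of record `coreOff_record_of_gradeTol_pairTabs` (`τ = 1/100`,
  `T = gradeTol R_g τ_in (1/100)`; census cells `R_g ∈ {53/10, 24/5}`, `τ_in ∈ {1/125, 1/150, 1/200}`), and ★ (R2) the recovery of GradStep's
  record `coreOff_of_envelope_tailCert_pairTabs` as the constant-table instance.

Tags, lens grammar and the census hooks (COVER-G, GRAD-77, CERT-G): module docstring of part 1.  Formal bookkeeping throughout; every proof closed, no new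
axioms, no instances / notation / options; zero edits to landed declarations.
-/

namespace Summit.AtomisticToContinuum.Crystallization.Theorems.FrustratedLawDichotomyStrainedPatchGradedStage

open scoped BigOperators Classical
open Summit.AtomisticToContinuum.Crystallization.Theorems.FrustratedLawDichotomyMotifLemmas
open Summit.AtomisticToContinuum.Crystallization.Theorems.FrustratedLawDichotomyRangeCut
open Summit.AtomisticToContinuum.Crystallization.Theorems.FrustratedLawDichotomyAveragingCut
open Summit.AtomisticToContinuum.Crystallization.Theorems.FrustratedLawDichotomyStrainedPatchHomSplit
open Summit.AtomisticToContinuum.Crystallization.Theorems.FrustratedLawDichotomyStrainedPatchCleanCollar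
open Summit.AtomisticToContinuum.Crystallization.Theorems.FrustratedLawDichotomyStrainedPatchPhaseCut
open Summit.AtomisticToContinuum.Crystallization.Theorems.FrustratedLawDichotomyStrainedPatchCoreTube
open Summit.AtomisticToContinuum.Crystallization.Theorems.FrustratedLawDichotomyStrainedPatchStrainBands
open Summit.AtomisticToContinuum.Crystallization.Theorems.FrustratedLawDichotomyStrainedPatchHomIsometry
open Summit.AtomisticToContinuum.Crystallization.Theorems.FrustratedLawDichotomyStrainedPatchHomTubeIso
open Summit.AtomisticToContinuum.Crystallization.Theorems.FrustratedLawDichotomyStrainedPatchEnvelopeLaw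
open Summit.AtomisticToContinuum.Crystallization.Theorems.FrustratedLawDichotomyStrainedPatchEnvelopeTaylor
open Summit.AtomisticToContinuum.Crystallization.Theorems.FrustratedLawDichotomyStrainedPatchChartFamilies
open Summit.AtomisticToContinuum.Crystallization.Theorems.FrustratedLawDichotomyStrainedPatchChartFamiliesPinned
open Summit.AtomisticToContinuum.Crystallization.Theorems.FrustratedLawDichotomyStrainedPatchQuantSlaving
open Summit.AtomisticToContinuum.Crystallization.Theorems.FrustratedLawDichotomyStrainedPatchHostCells
open Summit.AtomisticToContinuum.Crystallization.Theorems.FrustratedLawDichotomyStrainedPatchForceCap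
open Summit.AtomisticToContinuum.Crystallization.Theorems.FrustratedLawDichotomyStrainedPatchTextureFloor
open Summit.AtomisticToContinuum.Crystallization.Theorems.FrustratedLawDichotomyStrainedPatchSVCharge
open Summit.AtomisticToContinuum.Crystallization.Theorems.FrustratedLawDichotomyStrainedPatchChargePrice
open Summit.AtomisticToContinuum.Crystallization.Theorems.FrustratedLawDichotomyStrainedPatchTaylorTop
open Summit.AtomisticToContinuum.Crystallization.Theorems.FrustratedLawDichotomyStrainedPatchTaylorCharge
open Summit.AtomisticToContinuum.Crystallization.Theorems.FrustratedLawDichotomyStrainedPatchHostStep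
open Summit.AtomisticToContinuum.Crystallization.Theorems.FrustratedLawDichotomyStrainedPatchBondCalculus
open Summit.AtomisticToContinuum.Crystallization.Theorems.FrustratedLawDichotomyStrainedPatchFarSplit
open Summit.AtomisticToContinuum.Crystallization.Theorems.FrustratedLawDichotomyStrainedPatchTailPacking
open Summit.AtomisticToContinuum.Crystallization.Theorems.FrustratedLawDichotomyStrainedPatchRimFold
open Summit.AtomisticToContinuum.Crystallization.Theorems.FrustratedLawDichotomyStrainedPatchRowPrice
open Summit.AtomisticToContinuum.Crystallization.Theorems.FrustratedLawDichotomyStrainedPatchGradStep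
open Summit.AtomisticToContinuum.Crystallization.Theorems.FrustratedLawDichotomyStrainedPatchGradedTube
open Summit.AtomisticToContinuum.Crystallization.Theorems.FrustratedLawDichotomyStrainedPatchGradedDescent

/-! ## §3. The LP stage format on the GRADED global polytope: difference / pair tables, evaluations, bridges, graded boxes -/

/-- ★ **(HDIFF-G) `HostDiffTabG 𝓘 τ T σ r H F Y G`** [INSTRUMENTABLE · one LINEAR-objective sup per (host cell, occupancy, maybe-reach row, near partner,
direction) over the GRADED global row polytope]: `‖D h′ − D h‖ ≤ G(h, h′)`. -/
def HostDiffTabG (𝓘 : ChartFam) (τ : ℝ) (T : SlackTab) (σ r : ℝ) (H : HessTab) (F : ForceTab) (Y : SlackTab) (G : DiffTab) : Prop :=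
  ∀ (M₀ : ℕ) (z₀ : Fin M₀ → E3) (c₀ : Fin M₀), 𝓘 M₀ z₀ c₀ → ∀ (O : Finset (Fin M₀)) (D : Fin M₀ → E3), HostReadingG τ T z₀ c₀ O D →
    (∀ h ∈ O, HostSureReach τ z₀ c₀ O h → ‖hostLin H F z₀ c₀ O D h‖ ≤ σ + Y M₀ z₀ c₀ h) →
      ∀ h ∈ O, HostMaybeReach τ z₀ c₀ O h → ∀ h' ∈ hostNear r z₀ O h, ‖D h' - D h‖ ≤ G M₀ z₀ c₀ h h'

/-- ★ **(HPAIR-G) `HostPairTabG 𝓘 τ T σ r H F Y Pm G₁ G₂`** [INSTRUMENTABLE · LINEAR-objective sups over the GRADED global row polytope]: the across-pair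
first difference `‖D h′ − D h″‖ ≤ G₁(h, h′)` and the second difference `‖D h′ + D h″ − 2·D h‖ ≤ G₂(h, h′)`, `h″ = Pm(h′)`. -/
def HostPairTabG (𝓘 : ChartFam) (τ : ℝ) (T : SlackTab) (σ r : ℝ) (H : HessTab) (F : ForceTab) (Y : SlackTab) (Pm : PairMap) (G₁ G₂ : DiffTab) : Prop :=
  ∀ (M₀ : ℕ) (z₀ : Fin M₀ → E3) (c₀ : Fin M₀), 𝓘 M₀ z₀ c₀ → ∀ (O : Finset (Fin M₀)) (D : Fin M₀ → E3), HostReadingG τ T z₀ c₀ O D →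
    (∀ h ∈ O, HostSureReach τ z₀ c₀ O h → ‖hostLin H F z₀ c₀ O D h‖ ≤ σ + Y M₀ z₀ c₀ h) →
      ∀ h ∈ O, HostMaybeReach τ z₀ c₀ O h → ∀ h' ∈ hostNear r z₀ O h,
        ‖D h' - D (Pm M₀ z₀ c₀ O h h')‖ ≤ G₁ M₀ z₀ c₀ h h' ∧ ‖D h' + D (Pm M₀ z₀ c₀ O h h') - (2 : ℝ) • D h‖ ≤ G₂ M₀ z₀ c₀ h h'

/-- ★ **(DEVAL-G)** — the closed-form evaluation of the table `G` is `≤ P` at every maybe-reach row of every GRADED reading. [closed-form arithmetic] -/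
def DiffEvalTabG (𝓘 : ChartFam) (τ : ℝ) (T : SlackTab) (B : E3 → E3 →L[ℝ] E3 →L[ℝ] E3) (tl : ℝ → ℝ → ℝ) (r : ℝ) (G : DiffTab) (P : SlackTab) : Prop :=
  ∀ (M₀ : ℕ) (z₀ : Fin M₀ → E3) (c₀ : Fin M₀), 𝓘 M₀ z₀ c₀ → ∀ (O : Finset (Fin M₀)) (D : Fin M₀ → E3), HostReadingG τ T z₀ c₀ O D →
    ∀ h ∈ O, HostMaybeReach τ z₀ c₀ O h → diffEval B tl r z₀ O (G M₀ z₀ c₀ h) h ≤ P M₀ z₀ c₀ h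

/-- ★ **(PEVAL-G)** — the paired evaluation of the tables is `≤ P` at every maybe-reach row of every GRADED reading. [closed-form arithmetic] -/
def PairEvalTabG (𝓘 : ChartFam) (τ : ℝ) (T : SlackTab) (B : E3 → E3 →L[ℝ] E3 →L[ℝ] E3) (tl : ℝ → ℝ → ℝ) (r : ℝ) (Pm : PairMap) (G G₁ G₂ : DiffTab)
    (P : SlackTab) : Prop :=
  ∀ (M₀ : ℕ) (z₀ : Fin M₀ → E3) (c₀ : Fin M₀), 𝓘 M₀ z₀ c₀ → ∀ (O : Finset (Fin M₀)) (D : Fin M₀ → E3), HostReadingG τ T z₀ c₀ O D →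
    ∀ h ∈ O, HostMaybeReach τ z₀ c₀ O h →
      pairEval B tl r z₀ O (Pm M₀ z₀ c₀ O h) (G M₀ z₀ c₀ h) (G₁ M₀ z₀ c₀ h) (G₂ M₀ z₀ c₀ h) h ≤ P M₀ z₀ c₀ h

/-- THE GRADED BOX TABLE `T h + T h′`. -/
def boxTabG (T : SlackTab) : DiffTab := fun M₀ z₀ c₀ h h' => T M₀ z₀ c₀ h + T M₀ z₀ c₀ h'

/-- NEAR DOMINATION: `Tn(h)` bounds the table `T` on the `r`-near set of every row `h` (census datum: the max of `T` over the near shell; at a radial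
profile, `T` at host radius `R₀(h) + r`). -/
def NearDom (r : ℝ) (T Tn : SlackTab) : Prop :=
  ∀ (M₀ : ℕ) (z₀ : Fin M₀ → E3) (c₀ : Fin M₀) (O : Finset (Fin M₀)) (h : Fin M₀), ∀ h' ∈ hostNear r z₀ O h, T M₀ z₀ c₀ h' ≤ Tn M₀ z₀ c₀ h

/-- THE GRADED PAIR BOXES `T h′ + Tn h` (across-pair) and `T h′ + Tn h + 2·T h` (second difference). -/
def pairBoxG₁ (T Tn : SlackTab) : DiffTab := fun M₀ z₀ c₀ h h' => T M₀ z₀ c₀ h' + Tn M₀ z₀ c₀ h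
/-- See `pairBoxG₁`. -/
def pairBoxG₂ (T Tn : SlackTab) : DiffTab := fun M₀ z₀ c₀ h h' => T M₀ z₀ c₀ h' + Tn M₀ z₀ c₀ h + 2 * T M₀ z₀ c₀ h

section Tables

variable {𝓘 : ChartFam} {τ σ r : ℝ} {T T' Tn : SlackTab} {B : E3 → E3 →L[ℝ] E3 →L[ℝ] E3} {tl : ℝ → ℝ → ℝ} {H : HessTab} {F : ForceTab} {Y P : SlackTab}
  {Pm : PairMap} {G G₁ G₂ : DiffTab}

/-- At the constant table the graded box IS the box `2τ` of record. [formal bookkeeping] -/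
theorem boxTabG_constTol (τ : ℝ) : boxTabG (constTol τ) = boxTab τ := by
  funext M₀ z₀ c₀ h h'
  simp only [boxTabG, boxTab, constTol_apply]
  ring

/-- The graded box bound `‖D h′ − D h‖ ≤ T h + T h′` on a graded reading. [formal bookkeeping: `‖D‖ ≤ T` on `O`] -/
theorem diff_le_boxG {M₀ : ℕ} {z₀ : Fin M₀ → E3} {c₀ : Fin M₀} {O : Finset (Fin M₀)} {D : Fin M₀ → E3} (hR : HostReadingG τ T z₀ c₀ O D)
    {h h' : Fin M₀} (hh : h ∈ O) (hh' : h' ∈ hostNear r z₀ O h) : ‖D h' - D h‖ ≤ boxTabG T M₀ z₀ c₀ h h' := by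
  have h₁ := hR.2 h' (mem_of_mem_hostNear hh')
  have h₂ := hR.2 h hh
  simp only [boxTabG]
  linarith [norm_sub_le (D h') (D h)]

/-- ★ THE GRADED BASE RANGE: the graded box is a valid difference table on every host, column and radius. [formal bookkeeping] -/
theorem hostDiffTabG_box (𝓘 : ChartFam) (τ : ℝ) (T : SlackTab) (σ r : ℝ) (H : HessTab) (F : ForceTab) (Y : SlackTab) :
    HostDiffTabG 𝓘 τ T σ r H F Y (boxTabG T) :=
  fun _ _ _ _ _ _ hR _ _ hh _ _ hh' => diff_le_boxG hR hh hh'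

/-- ★ THE GRADED PAIR BOXES are valid pair tables for every admissible pairing under near domination. [formal bookkeeping] -/
theorem hostPairTabG_box (𝓘 : ChartFam) (τ σ : ℝ) (H : HessTab) (F : ForceTab) (Y : SlackTab) (hPm : PairAdm r Pm) (hn : NearDom r T Tn) :
    HostPairTabG 𝓘 τ T σ r H F Y Pm (pairBoxG₁ T Tn) (pairBoxG₂ T Tn) := by
  intro M₀ z₀ c₀ _ O D hR _ h hh _ h' hh'
  have h₀ := hR.2 h hh
  have h₁ := hR.2 h' (mem_of_mem_hostNear hh')
  have h₂ := hR.2 _ (mem_of_mem_hostNear (hPm M₀ z₀ c₀ O h h' hh').1)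
  have h₃ := hn M₀ z₀ c₀ O h _ (hPm M₀ z₀ c₀ O h h' hh').1
  have h2n : ‖(2 : ℝ) • D h‖ = 2 * ‖D h‖ := by rw [norm_smul, Real.norm_of_nonneg (by norm_num : (0 : ℝ) ≤ 2)]
  refine ⟨?_, ?_⟩
  · simp only [pairBoxG₁]; linarith [norm_sub_le (D h') (D (Pm M₀ z₀ c₀ O h h'))]
  · simp only [pairBoxG₂]
    linarith [norm_sub_le (D h' + D (Pm M₀ z₀ c₀ O h h')) ((2 : ℝ) • D h), norm_add_le (D h') (D (Pm M₀ z₀ c₀ O h h'))]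

/-- The record's LP tables are graded tables at every `T` (the graded polytope is smaller); graded tables are ANTITONE in `T`, MONOTONE in the table,
ANTITONE in the column. [formal bookkeeping] -/
theorem hostDiffTabG_of_hostDiffTab (T : SlackTab) (h : HostDiffTab 𝓘 τ σ r H F Y G) : HostDiffTabG 𝓘 τ T σ r H F Y G :=
  fun M₀ z₀ c₀ hI O D hR => h M₀ z₀ c₀ hI O D hR.1
/-- See `hostDiffTabG_of_hostDiffTab`. [formal bookkeeping] -/
theorem hostPairTabG_of_hostPairTab (T : SlackTab) (h : HostPairTab 𝓘 τ σ r H F Y Pm G₁ G₂) : HostPairTabG 𝓘 τ T σ r H F Y Pm G₁ G₂ :=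
  fun M₀ z₀ c₀ hI O D hR => h M₀ z₀ c₀ hI O D hR.1
/-- See `hostDiffTabG_of_hostDiffTab`. [formal bookkeeping] -/
theorem HostDiffTabG.anti_tol (h : HostDiffTabG 𝓘 τ T' σ r H F Y G) (hle : TolLE T T') : HostDiffTabG 𝓘 τ T σ r H F Y G :=
  fun M₀ z₀ c₀ hI O D hR => h M₀ z₀ c₀ hI O D (hR.mono_tol hle)
/-- See `hostDiffTabG_of_hostDiffTab`. [formal bookkeeping] -/
theorem HostPairTabG.anti_tol (h : HostPairTabG 𝓘 τ T' σ r H F Y Pm G₁ G₂) (hle : TolLE T T') : HostPairTabG 𝓘 τ T σ r H F Y Pm G₁ G₂ :=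
  fun M₀ z₀ c₀ hI O D hR => h M₀ z₀ c₀ hI O D (hR.mono_tol hle)
/-- See `hostDiffTabG_of_hostDiffTab`. [formal bookkeeping] -/
theorem HostDiffTabG.mono {Y' : SlackTab} {G' : DiffTab} (hY : ∀ (M₀ : ℕ) (z₀ : Fin M₀ → E3) (c₀ h : Fin M₀), Y' M₀ z₀ c₀ h ≤ Y M₀ z₀ c₀ h)
    (hG : ∀ (M₀ : ℕ) (z₀ : Fin M₀ → E3) (c₀ h h' : Fin M₀), G M₀ z₀ c₀ h h' ≤ G' M₀ z₀ c₀ h h') (h : HostDiffTabG 𝓘 τ T σ r H F Y G) :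
    HostDiffTabG 𝓘 τ T σ r H F Y' G' :=
  fun M₀ z₀ c₀ hI O D hR hL h₀ hh hm h' hh' =>
    (h M₀ z₀ c₀ hI O D hR (fun h'' hh'' hs => (hL h'' hh'' hs).trans (by linarith [hY M₀ z₀ c₀ h''])) h₀ hh hm h' hh').trans (hG M₀ z₀ c₀ h₀ h')

/-- The DEVAL / PEVAL evaluations of record are graded evaluations (fewer readings to bound). [formal bookkeeping] -/
theorem diffEvalTabG_of_diffEvalTab (T : SlackTab) (h : DiffEvalTab 𝓘 τ B tl r G P) : DiffEvalTabG 𝓘 τ T B tl r G P :=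
  fun M₀ z₀ c₀ hI O D hR => h M₀ z₀ c₀ hI O D hR.1
/-- See `diffEvalTabG_of_diffEvalTab`. [formal bookkeeping] -/
theorem pairEvalTabG_of_pairEvalTab (T : SlackTab) (h : PairEvalTab 𝓘 τ B tl r Pm G G₁ G₂ P) : PairEvalTabG 𝓘 τ T B tl r Pm G G₁ G₂ P :=
  fun M₀ z₀ c₀ hI O D hR => h M₀ z₀ c₀ hI O D hR.1

/-- ★★ **THE GRADED FIRST-DIFFERENCE BRIDGE** — (HDIFF-G G on Y) ∧ (DEVAL-G G ≤ P) ⟹ (HSTEP-G Y P). [formal bookkeeping: `hostQuad_le_diffEval`] -/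
theorem hostStepTabG_of_diffTabG (hT : TMono tl) (hG : HostDiffTabG 𝓘 τ T σ r H F Y G) (hP : DiffEvalTabG 𝓘 τ T B tl r G P) :
    HostStepTabG 𝓘 τ T σ B tl r H F Y P :=
  fun M₀ z₀ c₀ hI O D hR hL h hh hm =>
    (hostQuad_le_diffEval (g := G M₀ z₀ c₀ h) hT (hG M₀ z₀ c₀ hI O D hR hL h hh hm)).trans (hP M₀ z₀ c₀ hI O D hR h hh hm)

/-- ★★ **THE GRADED START TABLE** — (DEVAL-G of the graded box `T h + T h′` ≤ P) ⟹ (HTOP-G P): interior rows pay `2τ_in`, mixed rows `τ_in + τ_out`,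
rim rows `2τ_out` at the two-level profile. [formal bookkeeping] -/
theorem hostTopTabG_of_diffEvalTabG_box (hT : TMono tl) (hP : DiffEvalTabG 𝓘 τ T B tl r (boxTabG T) P) : HostTopTabG 𝓘 τ T B tl r P := by
  intro M₀ z₀ c₀ hI O D hR h hh hm
  have hg : ∀ h' ∈ hostNear r z₀ O h, ‖D h' - D h‖ ≤ boxTabG T M₀ z₀ c₀ h h' := fun h' hh' => diff_le_boxG hR hh hh'
  exact (hostQuad_le_diffEval hT hg).trans (hP M₀ z₀ c₀ hI O D hR h hh hm)

/-- ★★★ **THE GRADED PAIRED BRIDGE** — (HDIFF-G G) ∧ (HPAIR-G Pm G₁ G₂) on the column `Y`, an admissible pairing, (PEVAL-G ≤ P) ⟹ (HSTEP-G Y P).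
[formal bookkeeping: `hostQuad_le_pairEval`] -/
theorem hostStepTabG_of_pairTabG (hB : ∀ x u v : E3, B x u v = B x v u) (hT : TMono tl) (hPm : PairAdm r Pm) (hG : HostDiffTabG 𝓘 τ T σ r H F Y G)
    (hG₁₂ : HostPairTabG 𝓘 τ T σ r H F Y Pm G₁ G₂) (hP : PairEvalTabG 𝓘 τ T B tl r Pm G G₁ G₂ P) : HostStepTabG 𝓘 τ T σ B tl r H F Y P :=
  fun M₀ z₀ c₀ hI O D hR hL h hh hm =>
    (hostQuad_le_pairEval (g := G M₀ z₀ c₀ h) (g₁ := G₁ M₀ z₀ c₀ h) (g₂ := G₂ M₀ z₀ c₀ h) (π := Pm M₀ z₀ c₀ O h) hB hT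
      (fun h' hh' => (hPm M₀ z₀ c₀ O h h' hh').1) (fun h' hh' => (hPm M₀ z₀ c₀ O h h' hh').2)
      (hG M₀ z₀ c₀ hI O D hR hL h hh hm) (fun h' hh' => (hG₁₂ M₀ z₀ c₀ hI O D hR hL h hh hm h' hh').1)
      (fun h' hh' => (hG₁₂ M₀ z₀ c₀ hI O D hR hL h hh hm h' hh').2)).trans (hP M₀ z₀ c₀ hI O D hR h hh hm)

end Tables

/-! ## §4. Graded stage certificates and the T-leaf record in graded table currency -/

/-- A GRADED STAGE CERTIFICATE on the column `Y` with target table `P′`: graded difference tables, graded pair tables, graded paired evaluation. -/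
def StageCertG (𝓘 : ChartFam) (τ : ℝ) (T : SlackTab) (σ : ℝ) (B : E3 → E3 →L[ℝ] E3 →L[ℝ] E3) (tl : ℝ → ℝ → ℝ) (r : ℝ) (H : HessTab) (F : ForceTab)
    (Pm : PairMap) (Y P' : SlackTab) : Prop :=
  ∃ G G₁ G₂ : DiffTab, HostDiffTabG 𝓘 τ T σ r H F Y G ∧ HostPairTabG 𝓘 τ T σ r H F Y Pm G₁ G₂ ∧ PairEvalTabG 𝓘 τ T B tl r Pm G G₁ G₂ P'

section Record

variable {𝓘 : ChartFam} {τ σ s₀ r : ℝ} {T : SlackTab} {B : E3 → E3 →L[ℝ] E3 →L[ℝ] E3} {tl : ℝ → ℝ → ℝ} {H : HessTab} {F : ForceTab} {X Xh Xe Y P' : SlackTab}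
  {Pm : PairMap}

/-- A graded stage certificate is a graded per-row host step. [formal bookkeeping] -/
theorem hostStepTabG_of_stageCertG (hB : ∀ x u v : E3, B x u v = B x v u) (hT : TMono tl) (hPm : PairAdm r Pm)
    (h : StageCertG 𝓘 τ T σ B tl r H F Pm Y P') : HostStepTabG 𝓘 τ T σ B tl r H F Y P' := by
  obtain ⟨G, G₁, G₂, hG, hG₁₂, hP⟩ := h
  exact hostStepTabG_of_pairTabG hB hT hPm hG hG₁₂ hP

/-- A stage certificate of record is a graded stage certificate at every `T`; graded ones are ANTITONE in `T`. [formal bookkeeping] -/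
theorem stageCertG_of_stageCert (T : SlackTab) (h : StageCert 𝓘 τ σ B tl r H F Pm Y P') : StageCertG 𝓘 τ T σ B tl r H F Pm Y P' := by
  obtain ⟨G, G₁, G₂, hG, hG₁₂, hP⟩ := h
  exact ⟨G, G₁, G₂, hostDiffTabG_of_hostDiffTab T hG, hostPairTabG_of_hostPairTab T hG₁₂, pairEvalTabG_of_pairEvalTab T hP⟩
/-- See `stageCertG_of_stageCert`. [formal bookkeeping] -/
theorem StageCertG.anti_tol {T' : SlackTab} (h : StageCertG 𝓘 τ T' σ B tl r H F Pm Y P') (hle : TolLE T T') : StageCertG 𝓘 τ T σ B tl r H F Pm Y P' := by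
  obtain ⟨G, G₁, G₂, hG, hG₁₂, hP⟩ := h
  exact ⟨G, G₁, G₂, hG.anti_tol hle, hG₁₂.anti_tol hle, fun M₀ z₀ c₀ hI O D hR => hP M₀ z₀ c₀ hI O D (hR.mono_tol hle)⟩

/-- ★★★ **(TF-G) IN GRADED TABLE CURRENCY** — `TubeFloorG 𝓘 τ T` from: `2τ < s₀`, host separation, `r + 2τ ≤ 7`, (HFAR), (TAILCERT), a dominating
column `X ≥ Xh + Xe`, an admissible pairing, the START table by GRADED box evaluation, `n` GRADED LP stages on the columns `addCol X (P i)`, and the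
GRADED terminal certificate on `addCol X (P n)`.  [formal bookkeeping: `tubeFloorG_of_hostTabsG` + §3 + parts 3–5 of the landed tail packing] -/
theorem tubeFloorG_of_envelope_tailCert_pairTabsG (P : ℕ → SlackTab) (n : ℕ) (hτ : 0 ≤ τ) (hτs : 2 * τ < s₀) (hsep : HostSep 𝓘 s₀)
    (hr7 : r + 2 * τ ≤ 7) (hH : HostFarTab 𝓘 τ r Xh) (hTl : TailCert 𝓘 τ Xe)
    (hdom : ∀ (M₀ : ℕ) (z₀ : Fin M₀ → E3) (c₀ h : Fin M₀), Xh M₀ z₀ c₀ h + Xe M₀ z₀ c₀ h ≤ X M₀ z₀ c₀ h) (hPm : PairAdm r Pm)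
    (h0 : DiffEvalTabG 𝓘 τ T bondD3 (cubicTail fun s => gammaMaj (s - 2 * τ)) r (boxTabG T) (P 0))
    (hs : ∀ i : ℕ, i < n → StageCertG 𝓘 τ T sigmaOne bondD3 (cubicTail fun s => gammaMaj (s - 2 * τ)) r hessBlk0 force0 Pm (addCol X (P i)) (P (i + 1)))
    (hcert : SlackCertG 𝓘 τ T 0 sigmaOne hessBlk0 force0 (addCol X (P n))) : TubeFloorG 𝓘 τ T :=
  tubeFloorG_of_hostTabsG P n hτ (bondHessLip_env hτs) hsep (farColumn_mono hdom (farColumn_of_hostFarTab hr7 hτ hH (extTail_of_tailCert hTl)))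
    (hostTopTabG_of_diffEvalTabG_box (tMono_cubicTail_gammaMaj τ) h0)
    (fun i hi => hostStepTabG_of_stageCertG bondD3_symm (tMono_cubicTail_gammaMaj τ) hPm (hs i hi)) hcert

/-- ★★★ **THE T-LEAF RECORD IN GRADED TABLE CURRENCY** — `[CORE-FAR]` from the GRADED cover at `(τ, T)` and the data of
`tubeFloorG_of_envelope_tailCert_pairTabsG`.  [formal bookkeeping: g77's junction] -/
theorem coreOff_of_envelope_tailCert_pairTabsG (P : ℕ → SlackTab) (n : ℕ) (hτ : 0 ≤ τ) (hcov : FamilyCoverG 𝓘 (24 / 5) (1 / 100) (1 / 8) τ T)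
    (hτs : 2 * τ < s₀) (hsep : HostSep 𝓘 s₀) (hr7 : r + 2 * τ ≤ 7) (hH : HostFarTab 𝓘 τ r Xh) (hTl : TailCert 𝓘 τ Xe)
    (hdom : ∀ (M₀ : ℕ) (z₀ : Fin M₀ → E3) (c₀ h : Fin M₀), Xh M₀ z₀ c₀ h + Xe M₀ z₀ c₀ h ≤ X M₀ z₀ c₀ h) (hPm : PairAdm r Pm)
    (h0 : DiffEvalTabG 𝓘 τ T bondD3 (cubicTail fun s => gammaMaj (s - 2 * τ)) r (boxTabG T) (P 0))
    (hs : ∀ i : ℕ, i < n → StageCertG 𝓘 τ T sigmaOne bondD3 (cubicTail fun s => gammaMaj (s - 2 * τ)) r hessBlk0 force0 Pm (addCol X (P i)) (P (i + 1)))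
    (hcert : SlackCertG 𝓘 τ T 0 sigmaOne hessBlk0 force0 (addCol X (P n))) : CoreOffTubeFloor (63 / 10) (63 / 10) (24 / 5) (1 / 100) 0 :=
  coreOff_of_tubeFloorG_of_coverG_eighth (tubeFloorG_of_envelope_tailCert_pairTabsG P n hτ hτs hsep hr7 hH hTl hdom hPm h0 hs hcert) hcov

/-- ★★ **THE TWO-LEVEL INSTANCE AT THE SCALAR OF RECORD** — `τ = 1/100`, `T = gradeTol R_g τ_in (1/100)`: finite range `R₀ ≤ R_g` boxed at `τ_in`, rim at
`1/100`; START / stages / terminal on the graded polytope, graded cover (census cells `R_g ∈ {53/10, 24/5}`, `τ_in ∈ {1/125, 1/150, 1/200}`). -/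
theorem coreOff_record_of_gradeTol_pairTabs (Rg τin : ℝ) (P : ℕ → SlackTab) (n : ℕ)
    (hcov : FamilyCoverG 𝓘 (24 / 5) (1 / 100) (1 / 8) (1 / 100) (gradeTol Rg τin (1 / 100))) (hτs : 2 * (1 / 100 : ℝ) < s₀) (hsep : HostSep 𝓘 s₀)
    (hr7 : r + 2 * (1 / 100 : ℝ) ≤ 7) (hH : HostFarTab 𝓘 (1 / 100) r Xh) (hTl : TailCert 𝓘 (1 / 100) Xe)
    (hdom : ∀ (M₀ : ℕ) (z₀ : Fin M₀ → E3) (c₀ h : Fin M₀), Xh M₀ z₀ c₀ h + Xe M₀ z₀ c₀ h ≤ X M₀ z₀ c₀ h) (hPm : PairAdm r Pm)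
    (h0 : DiffEvalTabG 𝓘 (1 / 100) (gradeTol Rg τin (1 / 100)) bondD3 (cubicTail fun s => gammaMaj (s - 2 * (1 / 100))) r
      (boxTabG (gradeTol Rg τin (1 / 100))) (P 0))
    (hs : ∀ i : ℕ, i < n → StageCertG 𝓘 (1 / 100) (gradeTol Rg τin (1 / 100)) sigmaOne bondD3 (cubicTail fun s => gammaMaj (s - 2 * (1 / 100))) r
      hessBlk0 force0 Pm (addCol X (P i)) (P (i + 1)))
    (hcert : SlackCertG 𝓘 (1 / 100) (gradeTol Rg τin (1 / 100)) 0 sigmaOne hessBlk0 force0 (addCol X (P n))) :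
    CoreOffTubeFloor (63 / 10) (63 / 10) (24 / 5) (1 / 100) 0 :=
  coreOff_of_envelope_tailCert_pairTabsG P n (by norm_num) hcov hτs hsep hr7 hH hTl hdom hPm h0 hs hcert

/-- ★ (R2) RECOVERY OF GradStep's RECORD (`coreOff_of_envelope_tailCert_pairTabs`) as the constant-table instance: every graded hypothesis is implied by
the record's at `T = constTol τ` and the graded cover is the cover. [formal bookkeeping] -/
theorem coreOff_of_envelope_tailCert_pairTabs_via_graded (P : ℕ → SlackTab) (n : ℕ) (hτ : 0 ≤ τ) (hcov : FamilyCover 𝓘 (24 / 5) (1 / 100) (1 / 8) τ)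
    (hτs : 2 * τ < s₀) (hsep : HostSep 𝓘 s₀) (hr7 : r + 2 * τ ≤ 7) (hH : HostFarTab 𝓘 τ r Xh) (hTl : TailCert 𝓘 τ Xe)
    (hdom : ∀ (M₀ : ℕ) (z₀ : Fin M₀ → E3) (c₀ h : Fin M₀), Xh M₀ z₀ c₀ h + Xe M₀ z₀ c₀ h ≤ X M₀ z₀ c₀ h) (hPm : PairAdm r Pm)
    (h0 : DiffEvalTab 𝓘 τ bondD3 (cubicTail fun s => gammaMaj (s - 2 * τ)) r (boxTab τ) (P 0))
    (hs : ∀ i : ℕ, i < n → StageCert 𝓘 τ sigmaOne bondD3 (cubicTail fun s => gammaMaj (s - 2 * τ)) r hessBlk0 force0 Pm (addCol X (P i)) (P (i + 1)))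
    (hcert : SlackCert 𝓘 τ 0 sigmaOne hessBlk0 force0 (addCol X (P n))) : CoreOffTubeFloor (63 / 10) (63 / 10) (24 / 5) (1 / 100) 0 :=
  coreOff_of_envelope_tailCert_pairTabsG (T := constTol τ) P n hτ (familyCoverG_constTol_iff.2 hcov) hτs hsep hr7 hH hTl hdom hPm
    (by rw [boxTabG_constTol]; exact diffEvalTabG_of_diffEvalTab _ h0) (fun i hi => stageCertG_of_stageCert _ (hs i hi))
    (slackCertG_of_slackCert _ hcert)

end Record

end Summit.AtomisticToContinuum.Crystallization.Theorems.FrustratedLawDichotomyStrainedPatchGradedStage
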